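import Literature.NumberTheory.EllipticCurves.KernelReductionTateFormInertiaProofs
import Literature.NumberTheory.EllipticCurves.InertiaInvariantsMultiplicativeProofs
import Literature.NumberTheory.DiophantineGeometry.TateAlgorithmProofs
import HarnessLib

/-!
# At a place `v ∣ p` (`p` odd) of multiplicative reduction the inertia group moves `E[p]` into a
# subgroup of order `≤ p` (Serre 1972, §1.12, Cor. of Prop. 13 — the `(χ *; 0 1)` shape of the
# Tate curve — without the Tate curve)

`Proofs` file (theorems only, no definitions, no named facts), topic `NumberTheory/EllipticCurves`;
second sibling of `SemistableModPImage.lean` on the way to the named fact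
`Literature.NumberTheory.EllipticCurves.Edixhoven1997_prop_2_1` (Edixhoven 1997, Prop. 2.1 =
Serre 1972, §5.4, Prop. 21).  Serre's proof of Prop. 21 uses at the prime `l` itself, when `E` has
multiplicative reduction at `l`, the Corollary to Prop. 13 of §1.12 ("mauvaise réduction de type
multiplicatif": over an unramified extension `E` is the Tate curve, `0 → μ_l → E_l → ℤ/lℤ → 0`, so
the inertia group acts on `E_l` through `(χ *; 0 1)`: one of the two characters is unramified, the
other is the fundamental character of level `1`).  This file proves the part of that statement
needed for Lemme 6 and for §4.2's Lemme 2 at `v ∣ l`, over any number field `K`: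

* `exists_addEquiv_baseChange_of_j_eq_map_algEquiv_c₄c₆` — the isomorphism of two elliptic
  curves with the same `j ≠ 0, 1728` over an algebraically closed `L ⊇ F` (the tree's
  `exists_addEquiv_baseChange_of_j_eq_map_algEquiv`, Silverman *AEC* III.1.4(b), X.5.4) **with the
  twisting parameter made explicit**: `u² = r² · c₆(E) c₄(E') / (c₄(E) c₆(E'))`, `r ∈ Fˣ` — the
  quadratic twist class of two curves with the same `j` is `c₆/c₄ (mod squares)`;
* `WeierstrassCurve.exists_addSubgroup_card_le_of_hasMultiplicativeReductionAt` — **for an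
  elliptic curve `E/K`, an odd prime `p`, a place `v ∣ p` of multiplicative reduction and a prime
  `𝔓 ∣ v` of `\bar ℤ_K`, there is a subgroup `X ≤ E[p]` with `#X ≤ p` containing `τ P - P` for
  all `τ ∈ I_𝔓`, `P ∈ E[p]`** (so `I_𝔓` acts on `E[p]/X` trivially; with `det = χ̄_p` the line
  `X` carries the cyclotomic character, Serre's "demi-sous-groupe de Cartan déployé").

## Proof of the second statement

As in `KernelReductionTateFormInertiaProofs` (the potentially multiplicative case, which only
controls the squares `τ²`): transport `E(K̄) ↪ E(K̄_v) ≃ T(K̄_v)` to the Tate form of invariant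
`j(E)` over `K_v` (`tateFormOfJ`, `isTateForm_tateFormOfJ_of_one_lt`, `|j|_v > 1` at a
multiplicative place); on `T` every isometry `σ` moves the `p`-torsion into the kernel of
reduction `T₁` (`TateForm.one_lt_valuation_of_map_sub_eq_some_of_zsmul_eq_zero`), a subgroup
whose `p`-torsion has `≤ p` elements (`TateForm.card_addSubgroup_le_pow`).  The isomorphism
`E ≃ T` is the quadratic twist by `u`, `u² = r² c₆(E)c₄(T)/(c₄(E)c₆(T))`, and commutes with `σ`
exactly when `σ u = u`.  **New point**: when the reduction of `E` at `v` is multiplicative (not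
merely potentially multiplicative) and `p ≠ 2`, `c₄` and `c₆` of a minimal model of `E` and of
`T` are `v`-units, so `u² ∈ K_vˣ` is a unit times a square and every inertia element fixes `u`
(`|σ u' - u'| < 1` for the unit `u' ∈ u K_vˣ`, while `σ u' = -u'` would give `|2u'| = 1`).

## References

* [Serre1972] J.-P. Serre, *Propriétés galoisiennes des points d'ordre fini des courbes
  elliptiques*, Invent. Math. 15 (1972) 259–331: §1.12 (Prop. 13 and Cor.), §5.4 (Lemme 5,
  Lemme 6, proof of Prop. 21).
* [SilvermanAEC2009] J. H. Silverman, *The Arithmetic of Elliptic Curves*, 2nd ed.: III.1.4(b),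
  X.5.4, VII.5.1(b), VII.2.1.
* [SilvermanATAEC1994] J. H. Silverman, *Advanced Topics*: V.3–V.5 (the Tate curve).
-/

noncomputable section

open scoped Classical NNReal NumberField Pointwise
open NumberField IsDedekindDomain Field

universe u v

namespace Literature.NumberTheory.EllipticCurves

-- `_root_`: the import closure declares `Literature.NumberTheory.EllipticCurves.WeierstrassCurve.*`
open _root_.WeierstrassCurve

/-! ## Curves with the same `j`: the twisting parameter is `c₆/c₄` modulo squares -/

section SameJ

variable {F : Type u} [Field F] [CharZero F] (E E' : WeierstrassCurve F) [E.IsElliptic]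
  [E'.IsElliptic] (L : Type v) [Field L] [Algebra F L] [IsAlgClosed L] [DecidableEq L]

omit [CharZero F] in
/-- `j ≠ 0` forces `c₄ ≠ 0` (`j = c₄³/Δ`). [folklore] -/
theorem c₄_ne_zero_of_j_ne_zero (h0 : E.j ≠ 0) : E.c₄ ≠ 0 := by
  intro h
  apply h0
  rw [WeierstrassCurve.j, h, zero_pow three_ne_zero, mul_zero]

omit [CharZero F] in
/-- `j ≠ 1728` forces `c₆ ≠ 0` (`j - 1728 = c₆²/Δ`). [folklore] -/
theorem c₆_ne_zero_of_j_ne (h1728 : E.j ≠ 1728) : E.c₆ ≠ 0 := by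
  intro h
  apply h1728
  have hrel := E.c_relation
  rw [h, zero_pow two_ne_zero, sub_zero] at hrel
  rw [WeierstrassCurve.j, ← hrel, ← E.coe_Δ', mul_left_comm, E.Δ'.inv_mul, mul_one]

/-- **The isomorphism of two curves with the same `j ≠ 0, 1728` and the Galois action, with the
twisting parameter.**  Let `E, E'` be elliptic curves over a field `F` of characteristic `0` with
`j(E) = j(E') ∉ {0, 1728}` and `L ⊇ F` algebraically closed.  There are an isomorphism of groups
`e : E(L) ≃+ E'(L)` and `u ∈ Lˣ` with `u² = r² · c₆(E) c₄(E') / (c₄(E) c₆(E'))` for some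
`r ∈ Fˣ`, such that for every `σ ∈ Aut(L/F)`: `σ(u) = ±u`, and `e(P^σ) = e(P)^σ` if `σ(u) = u`,
`e(P^σ) = -e(P)^σ` if `σ(u) = -u`.  Same construction as the tree's
`exists_addEquiv_baseChange_of_j_eq_map_algEquiv` (Silverman, *AEC*, III.1.4(b), X.5.4: between
short models `y² = x³ + a₄x + a₆` the twist parameter is `d = (a₆/a₆')/(a₄/a₄')`, and
`a₆/a₄ = c₆/(18 c₄)` transforms under `(u, r, s, t)` by `u⁻²`), keeping track of `d`.
[cite: SilvermanAEC2009, Prop. III.1.4(b) and X.5.4] -/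
theorem exists_addEquiv_baseChange_of_j_eq_map_algEquiv_c₄c₆ (heq : E.j = E'.j) (h0 : E.j ≠ 0)
    (h1728 : E.j ≠ 1728) :
    ∃ (e : (E.baseChange L).toAffine.Point ≃+ (E'.baseChange L).toAffine.Point) (u : L),
      u ≠ 0 ∧ (∃ r : F, r ≠ 0 ∧ u ^ 2 = algebraMap F L (r ^ 2 * (E.c₆ * E'.c₄ / (E.c₄ * E'.c₆)))) ∧
      ∀ σ : L ≃ₐ[F] L, (σ u = u ∨ σ u = -u) ∧
        ∀ P : (E.baseChange L).toAffine.Point,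
          e (Affine.Point.map (σ : L →ₐ[F] L) P) =
            if σ u = u then Affine.Point.map (σ : L →ₐ[F] L) (e P)
            else -Affine.Point.map (σ : L →ₐ[F] L) (e P) := by
  letI : Invertible (2 : F) := invertibleOfNonzero two_ne_zero
  letI : Invertible (3 : F) := invertibleOfNonzero (by norm_num)
  obtain ⟨C₁, hC₁⟩ := E.exists_variableChange_isShortNF
  obtain ⟨C₂, hC₂⟩ := E'.exists_variableChange_isShortNF
  have hj₁ : (C₁ • E).j = (C₂ • E').j := by rw [variableChange_j, variableChange_j, heq]
  have h0₁ : (C₁ • E).j ≠ 0 := by rwa [variableChange_j]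
  have h1728₁ : (C₁ • E).j ≠ 1728 := by rwa [variableChange_j]
  set E₁ := C₁ • E with hE₁
  set E₂ := C₂ • E' with hE₂
  have h0₂ : E₂.j ≠ 0 := hj₁ ▸ h0₁
  have h1728₂ : E₂.j ≠ 1728 := hj₁ ▸ h1728₁
  have ha₄ : E₁.a₄ ≠ 0 := a₄_ne_zero_of_isShortNF h0₁
  have ha₆ : E₁.a₆ ≠ 0 := a₆_ne_zero_of_isShortNF h1728₁
  have ha₄' : E₂.a₄ ≠ 0 := a₄_ne_zero_of_isShortNF h0₂
  have ha₆' : E₂.a₆ ≠ 0 := a₆_ne_zero_of_isShortNF h1728₂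
  have hrel := a₄_pow_mul_a₆_sq_eq_of_j_eq hj₁
  -- the twisting parameter `d ∈ F` and its square root `u ∈ L`
  set d : F := E₁.a₆ / E₂.a₆ / (E₁.a₄ / E₂.a₄) with hd
  have hd0 : d ≠ 0 := by
    simp only [hd]
    exact div_ne_zero (div_ne_zero ha₆ ha₆') (div_ne_zero ha₄ ha₄')
  -- `d = (u₂/u₁)² · c₆(E) c₄(E') / (c₄(E) c₆(E'))`
  have hdc : d = ((C₂.u : F) / (C₁.u : F)) ^ 2 * (E.c₆ * E'.c₄ / (E.c₄ * E'.c₆)) := by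
    have h14 : E₁.c₄ = ↑C₁.u⁻¹ ^ 4 * E.c₄ := by rw [hE₁, variableChange_c₄]
    have h16 : E₁.c₆ = ↑C₁.u⁻¹ ^ 6 * E.c₆ := by rw [hE₁, variableChange_c₆]
    have h24 : E₂.c₄ = ↑C₂.u⁻¹ ^ 4 * E'.c₄ := by rw [hE₂, variableChange_c₄]
    have h26 : E₂.c₆ = ↑C₂.u⁻¹ ^ 6 * E'.c₆ := by rw [hE₂, variableChange_c₆]
    have s14 : E₁.c₄ = -48 * E₁.a₄ := c₄_of_isShortNF E₁
    have s16 : E₁.c₆ = -864 * E₁.a₆ := c₆_of_isShortNF E₁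
    have s24 : E₂.c₄ = -48 * E₂.a₄ := c₄_of_isShortNF E₂
    have s26 : E₂.c₆ = -864 * E₂.a₆ := c₆_of_isShortNF E₂
    have hEc₄ : E.c₄ ≠ 0 := c₄_ne_zero_of_j_ne_zero E h0
    have hEc₆' : E'.c₆ ≠ 0 := c₆_ne_zero_of_j_ne E' (heq ▸ h1728)
    have hu₁ : (C₁.u : F) ≠ 0 := C₁.u.ne_zero
    have hu₂ : (C₂.u : F) ≠ 0 := C₂.u.ne_zero
    have e14 : E₁.a₄ = -(↑C₁.u⁻¹ ^ 4 * E.c₄) / 48 := by linear_combination (s14 - h14) / 48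
    have e16 : E₁.a₆ = -(↑C₁.u⁻¹ ^ 6 * E.c₆) / 864 := by linear_combination (s16 - h16) / 864
    have e24 : E₂.a₄ = -(↑C₂.u⁻¹ ^ 4 * E'.c₄) / 48 := by linear_combination (s24 - h24) / 48
    have e26 : E₂.a₆ = -(↑C₂.u⁻¹ ^ 6 * E'.c₆) / 864 := by linear_combination (s26 - h26) / 864
    rw [hd, e14, e16, e24, e26]
    simp only [Units.val_inv_eq_inv_val]
    field_simp
  obtain ⟨u, hu⟩ := IsAlgClosed.exists_pow_nat_eq (algebraMap F L d) two_pos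
  have hu0 : u ≠ 0 := by
    rintro rfl
    rw [zero_pow two_ne_zero, eq_comm, map_eq_zero] at hu
    exact hd0 hu
  set f := algebraMap F L with hf
  have hu4 : u ^ 4 = f E₁.a₄ / f E₂.a₄ := by
    rw [pow_mul u 2 2, hu, hd]
    simp only [map_div₀]
    have : f E₂.a₄ ≠ 0 := (map_ne_zero f).mpr ha₄'
    have : f E₂.a₆ ≠ 0 := (map_ne_zero f).mpr ha₆'
    have : f E₁.a₄ ≠ 0 := (map_ne_zero f).mpr ha₄
    field_simp
    have := congrArg f hrel
    simp only [map_mul, map_pow] at this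
    linear_combination -this
  have hu6 : u ^ 6 = f E₁.a₆ / f E₂.a₆ := by
    rw [show u ^ 6 = u ^ 4 * u ^ 2 by ring, hu4, hu, hd]
    simp only [map_div₀]
    have : f E₂.a₄ ≠ 0 := (map_ne_zero f).mpr ha₄'
    have : f E₂.a₆ ≠ 0 := (map_ne_zero f).mpr ha₆'
    have : f E₁.a₄ ≠ 0 := (map_ne_zero f).mpr ha₄
    field_simp
  -- the scaling `D = ⟨u, 0, 0, 0⟩` carries `(E₁)_L` to `(E₂)_L`
  set D : VariableChange L := ⟨Units.mk0 u hu0, 0, 0, 0⟩ with hD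
  haveI hE₁L : (E₁.baseChange L).IsShortNF := by
    simp only [WeierstrassCurve.baseChange]
    constructor <;> simp [a₂_of_isShortNF]
  haveI hE₂L : (E₂.baseChange L).IsShortNF := by
    simp only [WeierstrassCurve.baseChange]
    constructor <;> simp [a₂_of_isShortNF]
  have hDE : D • E₁.baseChange L = E₂.baseChange L := by
    ext
    · simp [variableChange_a₁, hD]
    · simp [variableChange_a₂, a₂_of_isShortNF, hD]
    · simp [variableChange_a₃, hD]
    · simp only [variableChange_a₄, a₁_of_isShortNF, a₂_of_isShortNF, a₃_of_isShortNF, hD,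
        Units.val_inv_eq_inv_val, Units.val_mk0, mul_zero, sub_zero, add_zero]
      rw [show (E₁.baseChange L).a₄ = f E₁.a₄ from rfl,
        show (E₂.baseChange L).a₄ = f E₂.a₄ from rfl, inv_pow, hu4]
      have : f E₁.a₄ ≠ 0 := (map_ne_zero f).mpr ha₄
      field_simp
      ring
    · simp only [variableChange_a₆, a₁_of_isShortNF, a₂_of_isShortNF, a₃_of_isShortNF, hD,
        Units.val_inv_eq_inv_val, Units.val_mk0, mul_zero, sub_zero, add_zero]
      rw [show (E₁.baseChange L).a₆ = f E₁.a₆ from rfl,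
        show (E₂.baseChange L).a₆ = f E₂.a₆ from rfl, inv_pow, hu6]
      have : f E₁.a₆ ≠ 0 := (map_ne_zero f).mpr ha₆
      field_simp
      ring
  -- the composite isomorphism
  set e₁ := VariableChange.pointEquivBaseChange E C₁ L with he₁
  set e₂ := (VariableChange.pointEquiv (E₁.baseChange L) D).trans (Affine.Point.congrEquiv hDE)
    with he₂
  set e₄ := VariableChange.pointEquivBaseChange E' C₂ L with he₄
  have he₂_some : ∀ (x y : L) (h : (E₁.baseChange L).toAffine.Nonsingular x y),
      ∃ h', e₂ (.some x y h) = .some (D.toX x) (D.toY x y) h' := fun x y h ↦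
    ⟨hDE ▸ (VariableChange.nonsingular_iff _ D x y).mpr h, by
      rw [he₂, AddEquiv.trans_apply, VariableChange.pointEquiv_some,
        Affine.Point.congrEquiv_some]⟩
  have hDX : ∀ x : L, D.toX x = (u⁻¹) ^ 2 * x := fun x ↦ by
    simp [VariableChange.toX_def, hD]
  have hDY : ∀ x y : L, D.toY x y = (u⁻¹) ^ 3 * y := fun x y ↦ by
    simp [VariableChange.toY_def, hD]
  -- `u² ∈ F`, so `σ u = ±u`
  have hσu : ∀ σ : L ≃ₐ[F] L, σ u = u ∨ σ u = -u := fun σ ↦ by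
    have h2 : σ u ^ 2 = u ^ 2 := by rw [← map_pow, hu, AlgEquiv.commutes]
    have : (σ u - u) * (σ u + u) = 0 := by linear_combination h2
    rcases mul_eq_zero.mp this with h | h
    · exact Or.inl (sub_eq_zero.mp h)
    · exact Or.inr (eq_neg_of_add_eq_zero_left h)
  -- the behaviour of `e₂` under `σ`
  have he₂σ : ∀ (σ : L ≃ₐ[F] L) (Q : (E₁.baseChange L).toAffine.Point),
      e₂ (Affine.Point.map (σ : L →ₐ[F] L) Q) =
        if σ u = u then Affine.Point.map (σ : L →ₐ[F] L) (e₂ Q)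
        else -Affine.Point.map (σ : L →ₐ[F] L) (e₂ Q) := by
    intro σ Q
    rcases Q with _ | ⟨x, y, h⟩
    · simp only [← Affine.Point.zero_def, map_zero, neg_zero, ite_self]
    · set σ' : L →ₐ[F] L := (σ : L →ₐ[F] L)
      obtain ⟨hσ', hmapσ⟩ : ∃ h', Affine.Point.map σ' (.some x y h) = .some (σ' x) (σ' y) h' :=
        ⟨_, Affine.Point.map_some σ' h⟩
      obtain ⟨h₂, he₂P⟩ := he₂_some x y h
      obtain ⟨h₂σ, he₂σP⟩ := he₂_some (σ' x) (σ' y) hσ'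
      obtain ⟨h₃, hmap₃⟩ : ∃ h', Affine.Point.map σ' (.some (D.toX x) (D.toY x y) h₂) =
          .some (σ' (D.toX x)) (σ' (D.toY x y)) h' := ⟨_, Affine.Point.map_some σ' h₂⟩
      rw [hmapσ, he₂σP, he₂P, hmap₃]
      have hσinv : σ' u⁻¹ = (σ u)⁻¹ := map_inv₀ σ u
      have hX : D.toX (σ' x) = σ' (D.toX x) := by
        rw [hDX, hDX, map_mul, map_pow, hσinv]
        rcases hσu σ with h | h
        · rw [show σ u = u from h]
        · rw [show σ u = -u from h, inv_neg, neg_sq]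
      split_ifs with hfix
      · rw [Affine.Point.some.injEq]
        refine ⟨hX, ?_⟩
        rw [hDY, hDY, map_mul, map_pow, hσinv, show σ u = u from hfix]
      · have hneg : σ u = -u := (hσu σ).resolve_left hfix
        have hY : D.toY (σ' x) (σ' y) = -σ' (D.toY x y) := by
          rw [hDY, hDY, map_mul, map_pow, hσinv, hneg, inv_neg]
          ring
        have h₃' : (E₂.baseChange L).toAffine.Nonsingular (σ' (D.toX x)) (-σ' (D.toY x y)) := by
          rw [← hX, ← hY]; exact h₂σ
        rw [neg_some_of_a₁_a₃ (a₁_of_isShortNF (W := E₂.baseChange L))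
          (a₃_of_isShortNF (W := E₂.baseChange L)) h₃ h₃', Affine.Point.some.injEq]
        exact ⟨hX, hY⟩
  refine ⟨e₁.trans (e₂.trans e₄.symm), u, hu0, ⟨(C₂.u : F) / (C₁.u : F),
    div_ne_zero C₂.u.ne_zero C₁.u.ne_zero, ?_⟩, fun σ ↦ ⟨hσu σ, fun P ↦ ?_⟩⟩
  · rw [hu, hdc]
  have key : ∀ Q, (e₁.trans (e₂.trans e₄.symm)) Q = e₄.symm (e₂ (e₁ Q)) := fun Q ↦ rfl
  rw [key, key, he₁, VariableChange.pointEquivBaseChange_map_algEquiv, he₂σ]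
  split_ifs with hfix
  · rw [he₄, ← VariableChange.pointEquivBaseChange_symm_map]
  · rw [map_neg, he₄, ← VariableChange.pointEquivBaseChange_symm_map]

end SameJ


/-! ## Valuation lemmas -/

section Valuation

variable {L : Type*} [Field L] (w : Valuation L ℝ≥0)

/-- For a curve in Tate form, `c₄ = 1 - 48 a₄` is a unit of the valuation ring. [folklore] -/
theorem TateForm.IsTateForm.valuation_c₄ {T : WeierstrassCurve L} (hT : TateForm.IsTateForm w T) :
    w T.c₄ = 1 := by
  have hc₄ : T.c₄ = 1 - 48 * T.a₄ := by
    simp only [WeierstrassCurve.c₄, WeierstrassCurve.b₂, WeierstrassCurve.b₄, hT.a₁, hT.a₂, hT.a₃]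
    ring
  rw [hc₄]
  refine Valuation.map_one_sub_of_lt w ?_
  calc w (48 * T.a₄) = w (48 : L) * w T.a₄ := map_mul w _ _
    _ ≤ 1 * w T.a₄ := by
        gcongr
        exact_mod_cast w.map_natCast_le_one' 48
    _ < 1 := by rw [one_mul]; exact lt_of_le_of_lt hT.w_a₄_le hT.w_a₆_lt

/-- For a curve in Tate form, `c₆ = -1 + 72 a₄ - 864 a₆` is a unit of the valuation ring.
[folklore] -/
theorem TateForm.IsTateForm.valuation_c₆ {T : WeierstrassCurve L} (hT : TateForm.IsTateForm w T) :
    w T.c₆ = 1 := by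
  have hc₆ : T.c₆ = -(1 - (72 * T.a₄ - 864 * T.a₆)) := by
    simp only [WeierstrassCurve.c₆, WeierstrassCurve.b₂, WeierstrassCurve.b₄, WeierstrassCurve.b₆,
      hT.a₁, hT.a₂, hT.a₃]
    ring
  rw [hc₆, Valuation.map_neg]
  refine Valuation.map_one_sub_of_lt w ?_
  refine lt_of_le_of_lt (w.map_sub _ _) (max_lt ?_ ?_)
  · calc w (72 * T.a₄) = w (72 : L) * w T.a₄ := map_mul w _ _
      _ ≤ 1 * w T.a₄ := by
          gcongr
          exact_mod_cast w.map_natCast_le_one' 72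
      _ < 1 := by rw [one_mul]; exact lt_of_le_of_lt hT.w_a₄_le hT.w_a₆_lt
  · calc w (864 * T.a₆) = w (864 : L) * w T.a₆ := map_mul w _ _
      _ ≤ 1 * w T.a₆ := by
          gcongr
          exact_mod_cast w.map_natCast_le_one' 864
      _ < 1 := by rw [one_mul]; exact hT.w_a₆_lt

end Valuation

end Literature.NumberTheory.EllipticCurves

/-! ## The inertia group at a multiplicative `v ∣ p` moves `E[p]` into a subgroup of order `≤ p` -/

namespace WeierstrassCurve

open Literature.NumberTheory.EllipticCurves Literature.NumberTheory.GaloisRepresentations Field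
  IsDedekindDomain.HeightOneSpectrum

variable {K : Type u} [Field K] [NumberField K] (W : WeierstrassCurve K)

omit [NumberField K] in
/-- `2 ∉ v` for a place `v` containing an odd prime `p` (Bézout). [folklore] -/
theorem _root_.Literature.NumberTheory.EllipticCurves.two_not_mem_asIdeal_of_prime_mem
    {v : HeightOneSpectrum (𝓞 K)} {p : ℕ} (hp : p.Prime) (hp2 : p ≠ 2)
    (hpv : (p : 𝓞 K) ∈ v.asIdeal) : ((2 : ℤ) : 𝓞 K) ∉ v.asIdeal := by
  intro h2
  have hcop : Nat.Coprime 2 p := (Nat.coprime_primes Nat.prime_two hp).mpr (Ne.symm hp2)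
  have hbez := Nat.Coprime.gcd_eq_one hcop
  have key : (1 : 𝓞 K) ∈ v.asIdeal := by
    have h := Int.gcd_eq_gcd_ab 2 p
    rw [show Int.gcd (2 : ℤ) (p : ℤ) = Nat.gcd 2 p from rfl, hbez, Nat.cast_one] at h
    have h' : (1 : 𝓞 K) = ((2 : ℤ) : 𝓞 K) * (Int.gcdA 2 p : 𝓞 K) + (p : 𝓞 K) * (Int.gcdB 2 p : 𝓞 K) := by
      have := congrArg (fun z : ℤ ↦ (z : 𝓞 K)) h
      simpa only [Int.cast_one, Int.cast_add, Int.cast_mul, Int.cast_natCast] using this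
    rw [h']
    exact v.asIdeal.add_mem (v.asIdeal.mul_mem_right _ h2) (v.asIdeal.mul_mem_right _ hpv)
  exact v.isPrime.ne_top ((Ideal.eq_top_iff_one _).mpr key)

/-- **At a place `v ∣ p` (`p` odd) of multiplicative reduction, the inertia group moves `E[p]`
into a subgroup of order `≤ p`.**  Let `E/K` be an elliptic curve over a number field, `p` an odd
prime, `v ∣ p` a finite place of multiplicative reduction and `𝔓 ∣ v` a prime of `\bar ℤ_K` with
inertia group `I_𝔓 ≤ Γ_K`.  Then there is a subgroup `X ≤ E[p]` with `#X ≤ p` such that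
`τ P - P ∈ X` for all `τ ∈ I_𝔓` and `P ∈ E[p]`.  This is the content of Serre 1972, §1.12,
Cor. of Prop. 13 ("Si `E` a mauvaise réduction de type multiplicatif … `0 → μ_p → E_p → ℤ/pℤ → 0`
… `I_p` opère trivialement sur `ℤ/pℤ`") used in §5.4 (Lemme 6, and Lemme 2 at `v ∣ l`); proof in
the module docstring (Tate form of invariant `j` over `K_v`, to which `E` is isomorphic by a twist
that is unramified because the reduction is multiplicative and `p ≠ 2`).
[cite: Serre1972, §1.12, Cor. of Prop. 13; §5.4 Lemme 6] -/
theorem exists_addSubgroup_card_le_of_hasMultiplicativeReductionAt [W.IsElliptic]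
    {v : HeightOneSpectrum (𝓞 K)} {p : ℕ} [hp : Fact p.Prime] (hp2 : p ≠ 2)
    (hpv : (p : 𝓞 K) ∈ v.asIdeal) (hmult : W.HasMultiplicativeReductionAt v)
    {𝔓 : Ideal (absIntegers (𝓞 K) K)} (h𝔓 : 𝔓 ∈ v.primesAbove) :
    ∃ X : AddSubgroup (geomTorsion W (p : ℤ)), Nat.card X ≤ p ∧
      ∀ τ ∈ 𝔓.inertia (absoluteGaloisGroup K), ∀ P : geomTorsion W (p : ℤ),
        τ • P - P ∈ X := by
  obtain ⟨w, hw⟩ := v.exists_spectralValuation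
  obtain ⟨𝔐, h𝔐⟩ := v.localPrimesAbove_nonempty
  have hvw : w.Integers w.integer := Valuation.integer.integers w
  -- arrange `𝔓 = 𝔓_{ι,𝔐}` for an embedding `ι : K̄ → K̄_v`
  obtain ⟨g, hg⟩ := HeightOneSpectrum.exists_smul_eq_of_mem_primesAbove_holds
    (HeightOneSpectrum.primeBelow_mem_primesAbove
      (ι := closureEmb (K := K) (v.adicCompletion K)) h𝔐) h𝔓
  set ι : AlgebraicClosure K →ₐ[K] AlgebraicClosure (v.adicCompletion K) :=
    (closureEmb (K := K) (v.adicCompletion K)).comp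
      ((show AlgebraicClosure K ≃ₐ[K] AlgebraicClosure K from g⁻¹) :
        AlgebraicClosure K →ₐ[K] AlgebraicClosure K) with hι
  have h1 : 𝔓 = v.primeBelow ι 𝔐 := by
    rw [hι, HeightOneSpectrum.primeBelow_comp, ← hg]
    exact congrArg (· • _) (inv_inv g).symm
  -- the Tate form of invariant `j` over `K_v`
  have hjw : 1 < w (algebraMap K (AlgebraicClosure (v.adicCompletion K)) W.j) :=
    W.one_lt_spectralValuation_j_of_hasMultiplicativeReductionAt hw hmult
  obtain ⟨hj0, hj1728, hT, ha₆, -, -⟩ := W.isTateForm_tateFormOfJ_of_one_lt hjw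
  set jv : (v.adicCompletion K) := algebraMap K (v.adicCompletion K) W.j with hjv
  haveI hTell : (tateFormOfJ jv).IsElliptic := isElliptic_tateFormOfJ hj0 hj1728
  haveI : CharZero (v.adicCompletion K) := charZero_of_injective_algebraMap (algebraMap K (v.adicCompletion K)).injective
  have hjW : (W.baseChange (v.adicCompletion K)).j = jv := W.map_j _
  have hjE : (W.baseChange (v.adicCompletion K)).j = (tateFormOfJ jv).j := by
    rw [hjW, tateFormOfJ_j hj0 hj1728]
  have hjE0 : (W.baseChange (v.adicCompletion K)).j ≠ 0 := by rw [hjW]; exact hj0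
  have hjE1728 : (W.baseChange (v.adicCompletion K)).j ≠ 1728 := by rw [hjW]; exact hj1728
  -- the twisting isomorphism with its parameter
  obtain ⟨e, u, hu0, ⟨r, hr0, hur⟩, he⟩ := exists_addEquiv_baseChange_of_j_eq_map_algEquiv_c₄c₆
    (W.baseChange (v.adicCompletion K)) (tateFormOfJ jv) (AlgebraicClosure (v.adicCompletion K)) hjE hjE0 hjE1728
  set f := algebraMap (v.adicCompletion K) (AlgebraicClosure (v.adicCompletion K)) with hf
  -- (1) the minimal model `X = C • E_{K_v}` has unit `c₄`, `c₆`; so has the Tate form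
  obtain ⟨C, hC⟩ : ∃ C : VariableChange (v.adicCompletion K), W.localMinimalModel v = C • W.baseChange (v.adicCompletion K) :=
    ⟨_, rfl⟩
  set I := W.localMinimalIntegralModel v with hIdef
  obtain ⟨hΔm, hc₄m⟩ := (hasMultiplicativeReductionAt_iff_mem v W).mp hmult
  have hc₄u : IsUnit I.c₄ := by
    by_contra h
    exact hc₄m ((IsLocalRing.mem_maximalIdeal _).mpr (mem_nonunits_iff.mpr h))
  have hc₆u : IsUnit I.c₆ := by
    by_contra h
    have hc₆m : I.c₆ ∈ IsLocalRing.maximalIdeal _ :=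
      (IsLocalRing.mem_maximalIdeal _).mpr (mem_nonunits_iff.mpr h)
    apply hc₄m
    refine Ideal.IsPrime.mem_of_pow_mem inferInstance 3 ?_
    rw [show I.c₄ ^ 3 = I.c₆ ^ 2 + 1728 * I.Δ by linear_combination -I.c_relation]
    exact Ideal.add_mem _ (Ideal.pow_mem_of_mem _ hc₆m 2 two_pos) (Ideal.mul_mem_left _ _ hΔm)
  have hXI : I.baseChange (v.adicCompletion K) = W.localMinimalModel v :=
    baseChange_integralModel_eq (v.adicCompletionIntegers K) (W.localMinimalModel v)
  have hXc₄ : (W.localMinimalModel v).c₄ = algebraMap _ (v.adicCompletion K) I.c₄ := by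
    rw [← hXI]; exact (I.map_c₄ _)
  have hXc₆ : (W.localMinimalModel v).c₆ = algebraMap _ (v.adicCompletion K) I.c₆ := by
    rw [← hXI]; exact (I.map_c₆ _)
  have hwc₄ : w (f (W.localMinimalModel v).c₄) = 1 := by
    rw [hXc₄]; exact spectralValuation_eq_one_of_isUnit hw hc₄u
  have hwc₆ : w (f (W.localMinimalModel v).c₆) = 1 := by
    rw [hXc₆]; exact spectralValuation_eq_one_of_isUnit hw hc₆u
  have hEc₄ : (W.baseChange (v.adicCompletion K)).c₄ = (C.u : (v.adicCompletion K)) ^ 4 * (W.localMinimalModel v).c₄ := by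
    rw [hC, variableChange_c₄, Units.val_inv_eq_inv_val, ← mul_assoc, ← mul_pow,
      mul_inv_cancel₀ C.u.ne_zero, one_pow, one_mul]
  have hEc₆ : (W.baseChange (v.adicCompletion K)).c₆ = (C.u : (v.adicCompletion K)) ^ 6 * (W.localMinimalModel v).c₆ := by
    rw [hC, variableChange_c₆, Units.val_inv_eq_inv_val, ← mul_assoc, ← mul_pow,
      mul_inv_cancel₀ C.u.ne_zero, one_pow, one_mul]
  have hTc₄ : w (f (tateFormOfJ jv).c₄) = 1 := by
    rw [hf, ← map_c₄]; exact hT.valuation_c₄ w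
  have hTc₆ : w (f (tateFormOfJ jv).c₆) = 1 := by
    rw [hf, ← map_c₆]; exact hT.valuation_c₆ w
  have hXc₄0 : (W.localMinimalModel v).c₄ ≠ 0 := fun h0 ↦ by
    rw [h0, map_zero, Valuation.map_zero] at hwc₄; exact zero_ne_one hwc₄
  have hTc₆0 : (tateFormOfJ jv).c₆ ≠ 0 := fun h0 ↦ by
    rw [h0, map_zero, Valuation.map_zero] at hTc₆; exact zero_ne_one hTc₆
  have hXc₆0 : (W.localMinimalModel v).c₆ ≠ 0 := fun h0 ↦ by
    rw [h0, map_zero, Valuation.map_zero] at hwc₆; exact zero_ne_one hwc₆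
  have hTc₄0 : (tateFormOfJ jv).c₄ ≠ 0 := fun h0 ↦ by
    rw [h0, map_zero, Valuation.map_zero] at hTc₄; exact zero_ne_one hTc₄
  -- (2) the unit `u' = u · r⁻¹ · u_C⁻¹` with `u'² = c₆(X) c₄(T) / (c₄(X) c₆(T))`; so `|u'| = 1`
  set u' : (AlgebraicClosure (v.adicCompletion K)) := u * f (r⁻¹ * (C.u : (v.adicCompletion K))⁻¹) with hu'
  have hu'2 : u' ^ 2 = f ((W.localMinimalModel v).c₆ * (tateFormOfJ jv).c₄ /
      ((W.localMinimalModel v).c₄ * (tateFormOfJ jv).c₆)) := by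
    rw [hu', mul_pow, hur, ← map_pow, ← map_mul, hEc₄, hEc₆]
    congr 1
    have hCu : (C.u : (v.adicCompletion K)) ≠ 0 := C.u.ne_zero
    field_simp
  have hwu' : w u' = 1 := by
    have h2 : w u' ^ 2 = 1 := by
      rw [← Valuation.map_pow, hu'2, map_div₀, map_mul, map_mul, Valuation.map_div,
        Valuation.map_mul, Valuation.map_mul, hwc₆, hTc₄, hwc₄, hTc₆]
      simp
    exact (pow_eq_one_iff.mp h2).resolve_right two_ne_zero
  -- (3) every inertia element fixes `u`
  have h2w : w (2 : (AlgebraicClosure (v.adicCompletion K))) = 1 := by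
    have := spectralValuation_intCast_eq_one hw (two_not_mem_asIdeal_of_prime_mem hp.out hp2 hpv)
    simpa using this
  have hfixu : ∀ σ ∈ 𝔐.inertia (absoluteGaloisGroup (v.adicCompletion K)),
      absoluteGaloisGroup.toAlgEquiv (v.adicCompletion K) σ u = u := by
    intro σ hσ
    set σE : (AlgebraicClosure (v.adicCompletion K)) ≃ₐ[(v.adicCompletion K)] (AlgebraicClosure (v.adicCompletion K)) := absoluteGaloisGroup.toAlgEquiv _ σ with hσE
    rcases (he σE).1 with hfix | hneg
    · exact hfix
    · exfalso
      have hσu' : σE u' = -u' := by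
        rw [hu', map_mul, hneg, AlgEquiv.commutes, neg_mul]
      have hlt := (mem_inertia_iff_spectralValuation hw h𝔐).mp hσ u' hwu'.le
      have heq : σ • u' - u' = -(2 * u') := by
        change σE u' - u' = -(2 * u')
        rw [hσu']; ring
      rw [heq, Valuation.map_neg, Valuation.map_mul, h2w, hwu', one_mul] at hlt
      exact lt_irrefl _ hlt
  -- (4) the transport `Ψ : E(K̄) → T(K̄_v)`, equivariant for the inertia group
  haveI hint : ((tateFormOfJ jv).baseChange (AlgebraicClosure (v.adicCompletion K))).IsIntegral w.integer := by
    refine isIntegral_integer_of_val_le_one ?_ ?_ ?_ (hT.w_a₄_le.trans hT.w_a₆_lt.le)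
      hT.w_a₆_lt.le
    · rw [hT.a₁, map_one]
    · rw [hT.a₂, map_zero]; exact zero_le_one
    · rw [hT.a₃, map_zero]; exact zero_le_one
  let Φ : localPoints W (v.adicCompletion K) ≃+ ((tateFormOfJ jv).baseChange (AlgebraicClosure (v.adicCompletion K))).toAffine.Point :=
    (Affine.Point.congrEquiv (baseChange_baseChange_adicCompletion W v).symm).trans e
  have hΦ : ∀ σ ∈ 𝔐.inertia (absoluteGaloisGroup (v.adicCompletion K)), ∀ Q : localPoints W (v.adicCompletion K),
      Φ (σ • Q) = Affine.Point.map ((absoluteGaloisGroup.toAlgEquiv (v.adicCompletion K) σ : (AlgebraicClosure (v.adicCompletion K)) ≃ₐ[(v.adicCompletion K)] (AlgebraicClosure (v.adicCompletion K))) :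
        (AlgebraicClosure (v.adicCompletion K)) →ₐ[(v.adicCompletion K)] (AlgebraicClosure (v.adicCompletion K))) (Φ Q) := by
    intro σ hσ Q
    change e (Affine.Point.congrEquiv (baseChange_baseChange_adicCompletion W v).symm (σ • Q)) =
      Affine.Point.map ((absoluteGaloisGroup.toAlgEquiv (v.adicCompletion K) σ : (AlgebraicClosure (v.adicCompletion K)) ≃ₐ[(v.adicCompletion K)] (AlgebraicClosure (v.adicCompletion K))) : (AlgebraicClosure (v.adicCompletion K)) →ₐ[(v.adicCompletion K)] (AlgebraicClosure (v.adicCompletion K)))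
        (e (Affine.Point.congrEquiv (baseChange_baseChange_adicCompletion W v).symm Q))
    rw [congrEquiv_smul, (he _).2, if_pos (hfixu σ hσ)]
  set Ψ : geomPoints W →+ ((tateFormOfJ jv).baseChange (AlgebraicClosure (v.adicCompletion K))).toAffine.Point :=
    Φ.toAddMonoidHom.comp (pointsMapOfEmb W ι) with hΨ
  have hΨinj : Function.Injective Ψ := Φ.injective.comp (pointsMapOfEmb_injective W ι)
  -- the `𝒪_w`-model of the Tate form and the kernel of reduction
  obtain ⟨M, hM⟩ := hint.integral
  set X : AddSubgroup (geomTorsion W (p : ℤ)) :=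
    { carrier := {P | M.ReducesToZero (Affine.Point.congrEquiv hM (Ψ (P : geomPoints W)))}
      zero_mem' := by
        simp only [Set.mem_setOf_eq, ZeroMemClass.coe_zero, map_zero]
        exact reducesToZero_zero
      add_mem' := by
        intro P Q hP hQ
        simp only [Set.mem_setOf_eq, AddSubgroup.coe_add, map_add] at hP hQ ⊢
        exact hP.add hvw hQ
      neg_mem' := by
        intro P hP
        simp only [Set.mem_setOf_eq, AddSubgroup.coe_neg, map_neg] at hP ⊢
        exact hP.neg } with hXdef
  have hmemX : ∀ P : geomTorsion W (p : ℤ),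
      P ∈ X ↔ M.ReducesToZero (Affine.Point.congrEquiv hM (Ψ (P : geomPoints W))) :=
    fun P ↦ Iff.rfl
  have hp0 : ((p : ℕ) : ℤ) ≠ 0 := by exact_mod_cast hp.out.ne_zero
  haveI : Finite (geomTorsion W (p : ℤ)) := finite_torsionPoints_holds W (AlgebraicClosure K) hp0
  have hpL : (p : (AlgebraicClosure (v.adicCompletion K))) ≠ 0 := by
    rw [← map_natCast (algebraMap K (AlgebraicClosure (v.adicCompletion K))) p]
    exact (map_ne_zero_iff _ (algebraMap K (AlgebraicClosure (v.adicCompletion K))).injective).mpr (Nat.cast_ne_zero.mpr hp.out.ne_zero)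
  have hpw : w (p : (AlgebraicClosure (v.adicCompletion K))) < 1 := spectralValuation_natCast_lt_one hw hpv
  refine ⟨X, ?_, ?_⟩
  · -- `#X ≤ p`: `Ψ(X)` is a subgroup of `T₁(K̄_v)` killed by `p`
    set Ψ' : geomTorsion W (p : ℤ) →+ ((tateFormOfJ jv).baseChange (AlgebraicClosure (v.adicCompletion K))).toAffine.Point :=
      Ψ.comp (geomTorsion W (p : ℤ)).subtype with hΨ'
    have hΨ'inj : Function.Injective Ψ' := hΨinj.comp Subtype.val_injective
    set G := X.map Ψ' with hG
    have hGfin : (G : Set ((tateFormOfJ jv).baseChange (AlgebraicClosure (v.adicCompletion K))).toAffine.Point).Finite := by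
      rw [hG, AddSubgroup.coe_map]
      exact (Set.toFinite _).image Ψ'
    haveI : Finite G := hGfin.to_subtype
    have hcard : Nat.card X = Nat.card G :=
      Nat.card_congr (X.equivMapOfInjective Ψ' hΨ'inj).toEquiv
    rw [hcard]
    have hbound := TateForm.card_addSubgroup_le_pow (tateFormOfJ jv) hT hp2 hpw hpL 1 G ?_ ?_
    · simpa using hbound
    · -- the affine points of `G` lie in the kernel of reduction
      intro x y h hmem
      obtain ⟨P, hP, hPeq⟩ := AddSubgroup.mem_map.mp hmem
      have hP' := (hmemX P).mp hP
      have hPeq' : Ψ (P : geomPoints W) = .some x y h := hPeq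
      rw [hPeq', Affine.Point.congrEquiv_some, reducesToZero_some_iff,
        not_mem_range_iff hvw] at hP'
      exact hP'
    · intro Q hmem
      obtain ⟨P, -, rfl⟩ := AddSubgroup.mem_map.mp hmem
      have hP0 : ((p : ℕ) : ℤ) • (P : geomPoints W) = 0 := (Submodule.mem_torsionBy_iff _ _).mp P.2
      rw [pow_one, hΨ', AddMonoidHom.coe_comp, Function.comp_apply, AddSubgroup.coe_subtype,
        ← map_zsmul, hP0, map_zero]
  · -- `τ P - P ∈ X` for `τ ∈ I_𝔓`
    intro τ hτ P
    rw [h1] at hτ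
    obtain ⟨σ, hσI, hσ⟩ :=
      IsDedekindDomain.HeightOneSpectrum.exists_mem_inertia_apply_eq_holds v ι h𝔐 hτ
    have hres : resGalOfEmb ι σ = τ := resGalOfEmb_eq_of_apply_eq ι hσ
    set σE : (AlgebraicClosure (v.adicCompletion K)) ≃ₐ[(v.adicCompletion K)] (AlgebraicClosure (v.adicCompletion K)) := absoluteGaloisGroup.toAlgEquiv _ σ with hσE
    have hσ₁ : ∀ z : (AlgebraicClosure (v.adicCompletion K)), w (σE z) = w z := fun z ↦ spectralValuation_smul hw σ z
    have hΨτ : Ψ (τ • (P : geomPoints W)) = Affine.Point.map (σE : (AlgebraicClosure (v.adicCompletion K)) →ₐ[(v.adicCompletion K)] (AlgebraicClosure (v.adicCompletion K))) (Ψ P) := by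
      rw [hΨ, AddMonoidHom.coe_comp, Function.comp_apply, ← hres, pointsMapOfEmb_smul W ι σ]
      exact hΦ σ hσI _
    rw [hmemX]
    have hcoe : ((τ • P - P : geomTorsion W (p : ℤ)) : geomPoints W) = τ • (P : geomPoints W) - P := by
      rw [AddSubgroupClass.coe_sub, Literature.NumberTheory.EllipticCurves.AddSubgroup.torsionBy.coe_smul]
    rw [hcoe, map_sub, hΨτ]
    have hP0 : ((p ^ 1 : ℕ) : ℤ) • Ψ (P : geomPoints W) = 0 := by
      rw [pow_one, ← map_zsmul, (Submodule.mem_torsionBy_iff _ _).mp P.2, map_zero]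
    rcases hD : Affine.Point.map (σE : (AlgebraicClosure (v.adicCompletion K)) →ₐ[(v.adicCompletion K)] (AlgebraicClosure (v.adicCompletion K))) (Ψ P) - Ψ P with _ | ⟨s, t, hst⟩
    · rw [← Affine.Point.zero_def, map_zero]
      exact reducesToZero_zero
    · have hs : 1 < w s :=
        TateForm.one_lt_valuation_of_map_sub_eq_some_of_zsmul_eq_zero (tateFormOfJ jv) hT ha₆
          hp2 hpw σE hσ₁ (Ψ P) hP0 hD
      rw [Affine.Point.congrEquiv_some, reducesToZero_some_iff, not_mem_range_iff hvw]
      exact hs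

end WeierstrassCurve

end
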